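import Literature.NumberTheory.EllipticCurves.HeegnerPointsOfConductorGaloisOrbitPairProofs
import Literature.NumberTheory.EllipticCurves.HeegnerPointsLevelTransportOrders
import HarnessLib

/-!
# Shimura reciprocity at conductor `m`, PAIR FORM, WITHOUT `gcd(N, d_K) = 1` / `gcd(m, N) = 1`
# (Bezout engine of `HeegnerPointsLevelTransportOrders`; Gross 1984 §I.1, §5)

Topic `NumberTheory/EllipticCurves` (complex multiplication), namespace
`Literature.NumberTheory.EllipticCurves`.  THEOREMS ONLY (no definition, no named fact, no instance,
no notation).  Sequel of `HeegnerPointsOfConductorGaloisOrbitPairProofs`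
(`exists_ringEquiv_levelTransport_of_residue_congr`, `exists_mem_ringClassGal_map_pointGalHom_eq_of_residue_congr`:
`Gal(K[m]/K)` carries any Heegner point of conductor `m` onto every other one with the same
orientation residue, PROVIDED `gcd(N, d_K) = 1` and `gcd(m, N) = 1`).  Those two coprimality
hypotheses enter only through the lattice sandwich `Λ_{Nτ} = NΛ_τ + θ'Λ_τ` of
`HeegnerPointsLevelTransport.lean` (Bezout `uN + vβ = 1`); `HeegnerPointsLevelTransportOrders.lean` runs
the same engine under the weaker Bezout identity `uN + vβ + wc = 1`, `4Nc = β² − D`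
(`levelTransport_of_transport_lattice_eq_bezout`).  THIS file re-runs the pair-form transitivity with
that engine, for ANY negative discriminant `D = m² d_K` and any level `N`:

* `exists_ringEquiv_levelTransport_of_residue_congr_bezout` — `K` imaginary quadratic, `ι : K → ℂ`,
  `m ≠ 0`, Bezout data `(β, c, u, v, w)` with `4Nc = β² − m²d_K`, `uN + vβ + wc = 1`, and two Heegner
  forms `Q₁, Q₂` of level `N`, discriminant `m²d_K`, both of residue `β (mod 2N)`: some
  `σ ∈ Aut(ℂ/ι K)` has `LevelTransport N σ τ_{Q₁} τ_{Q₂}`;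
* `exists_mem_ringClassGal_map_pointGalHom_eq_of_residue_congr_bezout` — hence for every
  parametrisation datum `Dt` at level `N` and every `P ∈ E(K[m])` over `φ(τ_{Q₁})` there is
  `σ′ ∈ 𝒢_m = Gal(K[m]/K)` with `σ′ • P ↦ φ(τ_{Q₂})`.

The case the tree needs (crux `UpperOffV0HSYPlus`, stmt-BirchSwinnertonDyer-19804, Gross's Prop. 5.3
on Hu–Shu–Yin's CM tower of conductor `9pn` on `X₀(3⁵)`, `K = ℚ(√−3)`, `3 ∣ N` ramified): Bezout
`u·243 + w·c = 1` is `HuShuYin2019.isCoprime_bezoutC` (as in `levelTransport_self_sylvesterPoint_of_fix`).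
Proof: verbatim the sibling's (class equation `exists_ringEquiv_apply_formJ_principalForm_eq` twice,
Cox Thm. 10.9 `exists_lattice_eq_mulLeft_of_j_eq`, the engine, `isAutEquivariantOnHeegner`,
`ringEquiv_apply_mem_ringClassField_iff`).

## References
* B. H. Gross, *Heegner points on `X₀(N)`*, in *Modular Forms* (Durham 1983), 1984, §I.1, §5. [Gross1984]
* H. Darmon, *Rational Points on Modular Elliptic Curves*, CBMS 101 (2004), Thms. 3.6–3.7. [Darmon2004]
* D. A. Cox, *Primes of the form x² + ny²*, 2nd ed. (2013), Thm. 10.9, Thm. 11.1, §12.A. [Cox2013]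

## Mathlib / tree search
Tree: `exists_ringEquiv_levelTransport_of_residue_congr` (coprime twin), `levelTransport_of_transport_lattice_eq_bezout`
(engine), `exists_ringEquiv_apply_formJ_principalForm_eq`, `exists_lattice_eq_mulLeft_of_j_eq`,
`isAutEquivariantOnHeegner`, `ringEquiv_apply_mem_ringClassField_iff`.
`lean search 'residue_congr_bezout'` → nothing before this file.
-/

noncomputable section

open scoped Classical

namespace Literature.NumberTheory.EllipticCurves

open ModularForms NumberField PeriodPair
open Literature.NumberTheory.QuadraticFields.BinaryQuadraticForm
open Literature.NumberTheory.QuadraticFields.Quadratic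

variable {K : Type} [Field K] [NumberField K]

/-- `√(m²D) = m√D` for the normalised square roots `sqrtDisc`. [folklore] -/
private theorem sqrtDisc_sq_mul_bezout (D : ℤ) (m : ℕ) :
    sqrtDisc ((m : ℤ) ^ 2 * D) = (m : ℂ) * sqrtDisc D := by
  unfold sqrtDisc
  have hm : (0 : ℝ) ≤ m := Nat.cast_nonneg m
  have h : -(((m : ℤ) ^ 2 * D : ℤ) : ℝ) = (m : ℝ) ^ 2 * (-(D : ℝ)) := by push_cast; ring
  rw [h, Real.sqrt_mul (sq_nonneg _), Real.sqrt_sq hm]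
  push_cast
  ring

/-- **Shimura reciprocity at conductor `m`, transport form, for a PAIR of Heegner forms — Bezout form**
(no coprimality of `N` with `d_K` or `m`).  For `K` imaginary quadratic, `ι : K → ℂ`, `m ≠ 0`, Bezout
data `4Nc = β² − m²d_K`, `uN + vβ + wc = 1`, and Heegner forms `Q₁`, `Q₂` of level `N`, discriminant
`m²d_K`, residues `B₁ ≡ β ≡ B₂ (mod 2N)`, some automorphism `σ` of `ℂ` fixing `ι(K)` pointwise has
`LevelTransport N σ τ_{Q₁} τ_{Q₂}` (`Pic(𝒪_m)` simply transitive on the CM points of `𝒪_m` with a fixed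
level-`N` structure of type `β`). [cite: Gross1984, §I.1] [cite: Darmon2004, Thm. 3.7 (PDF p. 44)]
[cite: Cox2013, Thm. 10.9, Thm. 11.1] -/
theorem exists_ringEquiv_levelTransport_of_residue_congr_bezout (hK : IsImaginaryQuadratic K)
    (ι : K →+* ℂ) {N : ℕ} [NeZero N] {m : ℕ} (hm : m ≠ 0) {β c u v w : ℤ}
    (hc : 4 * N * c = β ^ 2 - (m : ℤ) ^ 2 * NumberField.discr K) (huvw : u * N + v * β + w * c = 1)
    {Q₁ Q₂ : ℤ × ℤ × ℤ}
    (hQ₁ : Q₁ ∈ heegnerForms N ((m : ℤ) ^ 2 * NumberField.discr K))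
    (hQ₂ : Q₂ ∈ heegnerForms N ((m : ℤ) ^ 2 * NumberField.discr K))
    (hβ₁ : Q₁.2.1 ≡ β [ZMOD 2 * N]) (hβ₂ : Q₂.2.1 ≡ β [ZMOD 2 * N]) :
    ∃ σ : ℂ ≃+* ℂ, (∀ k : K, σ (ι k) = ι k) ∧
      LevelTransport N σ (heegnerTau Q₁) (heegnerTau Q₂) := by
  set D : ℤ := NumberField.discr K
  have hD : D < 0 := hK.discr_neg
  have hm0 : (0 : ℤ) < m := by exact_mod_cast Nat.pos_of_ne_zero hm
  have hDm : (m : ℤ) ^ 2 * D < 0 := mul_neg_of_pos_of_neg (pow_pos hm0 2) hD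
  -- primitivity / positivity / discriminants of the two forms
  have hQ₁' := hQ₁
  obtain ⟨hdisc₁, hA₁, -, hprim₁⟩ := hQ₁'
  have hQ₂' := hQ₂
  obtain ⟨hdisc₂, hA₂, -, hprim₂⟩ := hQ₂'
  have hprimQ₁ : IsPrimitive Q₁ :=
    (isPrimitive_iff_binQF Q₁).mpr ((BinQF.isPrimitive_iff _).mpr hprim₁)
  have hprimQ₂ : IsPrimitive Q₂ :=
    (isPrimitive_iff_binQF Q₂).mpr ((BinQF.isPrimitive_iff _).mpr hprim₂)
  have hdiscQ₁ : discr Q₁ = (m : ℤ) ^ 2 * D := hdisc₁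
  have hdiscQ₂ : discr Q₂ = (m : ℤ) ^ 2 * D := hdisc₂
  -- `σ₁(j(𝒪_m)) = j(τ_{Q₂})`, `σ₂(j(𝒪_m)) = j(τ_{Q₁})`, both fixing `ι(K)`
  obtain ⟨σ₁, hσ₁K, hσ₁j⟩ :=
    exists_ringEquiv_apply_formJ_principalForm_eq hK ι hA₂ hprimQ₂ (by rw [hdiscQ₂]; exact hDm)
  obtain ⟨σ₂, hσ₂K, hσ₂j⟩ :=
    exists_ringEquiv_apply_formJ_principalForm_eq hK ι hA₁ hprimQ₁ (by rw [hdiscQ₁]; exact hDm)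
  rw [hdiscQ₂] at hσ₁j
  rw [hdiscQ₁] at hσ₂j
  -- `σ = σ₁ ∘ σ₂⁻¹` fixes `ι(K)` and carries `j(τ_{Q₁})` to `j(τ_{Q₂})`
  refine ⟨σ₂.symm.trans σ₁, fun k ↦ ?_, ?_⟩
  · rw [RingEquiv.trans_apply, (RingEquiv.symm_apply_eq σ₂).mpr (hσ₂K k).symm, hσ₁K k]
  have hσK : ∀ k : K, (σ₂.symm.trans σ₁) (ι k) = ι k := fun k ↦ by
    rw [RingEquiv.trans_apply, (RingEquiv.symm_apply_eq σ₂).mpr (hσ₂K k).symm, hσ₁K k]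
  have hσj : (σ₂.symm.trans σ₁) (formJ Q₁) = formJ Q₂ := by
    rw [RingEquiv.trans_apply, (RingEquiv.symm_apply_eq σ₂).mpr hσ₂j.symm, hσ₁j]
  -- `σ` fixes `√(m²D) = m√D`
  have hσD : (σ₂.symm.trans σ₁) (sqrtDisc ((m : ℤ) ^ 2 * D)) = sqrtDisc ((m : ℤ) ^ 2 * D) := by
    rw [sqrtDisc_sq_mul_bezout, map_mul, map_natCast, apply_sqrtDisc_discr_eq hK ι hσK]
  -- transport `Λ_{τ_{Q₁}}` along `σ`: same `j` as `Λ_{τ_{Q₂}}`, hence homothetic to it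
  obtain ⟨M, hM⟩ := exists_isTransportedBy (σ₂.symm.trans σ₁) (ofUpperHalfPlane (heegnerTau Q₁))
  have hjM : (ofUpperHalfPlane (heegnerTau Q₂)).j = M.j := by
    rw [hM.j_eq, ← formJ_def, ← formJ_def, hσj]
  obtain ⟨c₀, hc₀, hMc⟩ := exists_lattice_eq_mulLeft_of_j_eq hjM
  exact levelTransport_of_transport_lattice_eq_bezout hDm hc huvw hσD hQ₁ hβ₁ hQ₂ hβ₂ hM hc₀ hMc

/-- **Shimura reciprocity at conductor `m`, orbit form, for a PAIR of Heegner points — Bezout form**: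
for `K` imaginary quadratic, `m ≠ 0`, Bezout data `4Nc = β² − m²d_K`, `uN + vβ + wc = 1`, a
parametrisation datum `Dt` of `W` at level `N`, Heegner forms `Q₁`, `Q₂` of level `N`, discriminant
`m²d_K`, residues `≡ β (mod 2N)`, and ANY `P ∈ E(K[m])` with complex image `φ(τ_{Q₁})`, **some
`σ′ ∈ 𝒢_m = Gal(K[m]/K)` has `σ′ • P ↦ φ(τ_{Q₂})`** (Darmon 2004, Thm. 3.7 with Thm. 3.6, for orders
and levels with common / ramified primes). [cite: Darmon2004, Thm. 3.7 (PDF p. 44), Thm. 3.6 (PDF p. 43)]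
[cite: Gross1984, §I.1, §5] -/
theorem exists_mem_ringClassGal_map_pointGalHom_eq_of_residue_congr_bezout (hK : IsImaginaryQuadratic K)
    (ι : K →+* ℂ) {N : ℕ} [NeZero N] {W : WeierstrassCurve ℚ} (Dt : ModularParametrizationData W N)
    {m : ℕ} (hm : m ≠ 0) {β c u v w : ℤ}
    (hc : 4 * N * c = β ^ 2 - (m : ℤ) ^ 2 * NumberField.discr K) (huvw : u * N + v * β + w * c = 1)
    {Q₁ Q₂ : ℤ × ℤ × ℤ}
    (hQ₁ : Q₁ ∈ heegnerForms N ((m : ℤ) ^ 2 * NumberField.discr K))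
    (hQ₂ : Q₂ ∈ heegnerForms N ((m : ℤ) ^ 2 * NumberField.discr K))
    (hβ₁ : Q₁.2.1 ≡ β [ZMOD 2 * N]) (hβ₂ : Q₂.2.1 ≡ β [ZMOD 2 * N])
    {P : (W.baseChange (ringClassField K ι m)).toAffine.Point}
    (hP : WeierstrassCurve.Affine.Point.map (W' := W) (ringClassField K ι m).subtype.toRatAlgHom P =
      Dt.φ (heegnerTau Q₁)) :
    ∃ σ' ∈ ringClassGal ι m,
      WeierstrassCurve.Affine.Point.map (W' := W) (ringClassField K ι m).subtype.toRatAlgHom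
          (pointGalHom W (ringClassField K ι m) σ' P) = Dt.φ (heegnerTau Q₂) := by
  set D : ℤ := NumberField.discr K
  obtain ⟨σ, hσK, hT⟩ :=
    exists_ringEquiv_levelTransport_of_residue_congr_bezout hK ι hm hc huvw hQ₁ hQ₂ hβ₁ hβ₂
  -- `σ` fixes `√(m²D)`
  have hσD : σ (sqrtDisc ((m : ℤ) ^ 2 * D)) = sqrtDisc ((m : ℤ) ^ 2 * D) := by
    rw [sqrtDisc_sq_mul_bezout, map_mul, map_natCast, apply_sqrtDisc_discr_eq hK ι hσK]
  -- `σ` restricted to `K[m]` (which it stabilises) is an element `σ'` of `𝒢_m`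
  have hmem : ∀ x : ℂ, σ x ∈ ringClassField K ι m ↔ x ∈ ringClassField K ι m :=
    ringEquiv_apply_mem_ringClassField_iff hK ι hm hσK
  let e : ringClassField K ι m ≃+* ringClassField K ι m :=
    { toFun := fun x ↦ ⟨σ x, (hmem x).mpr x.2⟩
      invFun := fun x ↦ ⟨σ.symm x, (hmem (σ.symm x)).mp (by rw [σ.apply_symm_apply]; exact x.2)⟩
      left_inv := fun x ↦ Subtype.ext (σ.symm_apply_apply x)
      right_inv := fun x ↦ Subtype.ext (σ.apply_symm_apply x)
      map_mul' := fun x y ↦ Subtype.ext (map_mul σ (x : ℂ) (y : ℂ))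
      map_add' := fun x y ↦ Subtype.ext (map_add σ (x : ℂ) (y : ℂ)) }
  have he : ∀ x : ringClassField K ι m, ((e x : ringClassField K ι m) : ℂ) = σ x := fun _ ↦ rfl
  let σ' : ringClassField K ι m ≃ₐ[ℚ] ringClassField K ι m :=
    AlgEquiv.ofRingEquiv (f := e) fun q ↦ by
      apply Subtype.ext
      rw [he]
      simp only [eq_ratCast, SubfieldClass.coe_ratCast, map_ratCast]
  have hσ'x : ∀ x : ringClassField K ι m, ((σ' x : ringClassField K ι m) : ℂ) = σ x := fun x ↦ by
    rw [AlgEquiv.ofRingEquiv_apply, he]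
  have hσ'mem : σ' ∈ ringClassGal ι m := by
    rw [ringClassGal, mem_fixingSubgroup_iff]
    rintro x ⟨k, hk⟩
    apply Subtype.ext
    rw [AlgEquiv.smul_def, hσ'x, ← hk, hσK k]
  refine ⟨σ', hσ'mem, ?_⟩
  -- the parametrisation is `Aut(ℂ)`-equivariant along the transport
  have hφ : Dt.IsAutEquivariantOnHeegner ((m : ℤ) ^ 2 * D) := Dt.isAutEquivariantOnHeegner _
  calc WeierstrassCurve.Affine.Point.map (ringClassField K ι m).subtype.toRatAlgHom
          (pointGalHom W (ringClassField K ι m) σ' P)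
      = WeierstrassCurve.Affine.Point.map ((σ : ℂ →+* ℂ)).toRatAlgHom
          (WeierstrassCurve.Affine.Point.map (ringClassField K ι m).subtype.toRatAlgHom P) := by
        rw [pointGalHom_apply, WeierstrassCurve.Affine.Point.map_map,
          WeierstrassCurve.Affine.Point.map_map]
        exact WeierstrassCurve.Affine.Point.map_congr_fun (fun x ↦ hσ'x x) _
    _ = Dt.φ (heegnerTau Q₂) := by
        rw [hP]
        exact hφ σ hσD hQ₁ hQ₂ hT

end Literature.NumberTheory.EllipticCurves

end
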